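import Mathlib.Analysis.Calculus.MeanValue
import Mathlib.Analysis.SpecialFunctions.ExpDeriv
import HarnessLib

/-!
# The Euler remainder lemma: `|φ(1) − ½φ′(1)| ≤ ½·osc_{[0,1]} φ″` when `φ(0) = φ′(0) = 0`

The virial remainder `R = F̂ − ½XF̂` of the window row (✓`virial_ring`; memo2 remarks 3–4) is "third order at the flat point" along the Euler flow.  This
file isolates the one-variable calculus fact behind that phrase (pure Mathlib), in the form the valley analysis and the followers' remainder bound will use:
with `φ(t) = F̂(eulerDilate t η)` one has `F̂ = φ(1)`, `XF̂ = φ′(1) = d/ds|₀ φ(e^s)`, `φ(0) = 0` (flat axial point), `φ′(0) = 0` (minimum), hence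

* `hasDerivAt_euler_antiderivative` — `d/dt [φ(t) + (½ − t)φ′(t)] = (½ − t)φ″(t)` (so `R = ∫₀¹ (½ − t)φ″ dt`);
* ★★ `abs_sub_half_deriv_le_of_osc` — `|φ(1) − ½φ′(1)| ≤ ½·sup_{[0,1]} |φ″(t) − φ″(0)|`;  ★★ `abs_sub_half_deriv_le_of_third` — `≤ ½·sup_{[0,1]} |φ‴|`
  (mean-value inequality for `K(t) = φ(t) + (½ − t)φ′(t) − (t/2 − t²/2)φ″(0)`);
* `hasDerivAt_comp_exp_zero` (`d/ds|₀ φ(e^s) = φ′(1)`), ★ `abs_sub_half_flowDeriv_le_of_third` — the same bound with the flow derivative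
  `deriv (s ↦ φ(e^s)) 0` (the shape of ✓`gnoXDeficit`).
So `|R(η)| ≤ ½·sup_t |d³/dt³ F̂(eulerDilate t η)|`: cubic in the dilated coordinates, with the chart's third derivatives as constants — for follower-only
bond terms `O((L³√F̂)³)` by ✓`chartBox_of_chartDeficit` (memo2 remark 4), for leader-touching terms the valley term.

HONEST LABEL: elementary calculus (no ring, no measure); nothing about ⟨24197⟩ (window-uniform, OPEN) is proved; ⟨24194⟩ ∕ ⟨24497⟩ OPEN; own crux ⟨22884⟩ OPEN
(blocked-on ⟨19935⟩); no crux, rung of record or summit is proved; the Yang–Mills mass gap is NOT proved; no summit is proved by a line.  THEOREMS ONLY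
(0 `def`, 0 `sorry`), standard axioms, Mathlib-only imports.  Width seat ym-line-sfw-p2-w2 g57 (cell ym-idea-1, free hands), `--supports stmt-QuantumFields-24197`.
References: [folklore] (Taylor ∕ Euler's identity for homogeneous functions).
-/

set_option autoImplicit false

noncomputable section

open Set

namespace Summit.QuantumFields.YangMills.Theorems.SwapVirialDeficit.Gnomonic

/-- ★ **THE EULER REMAINDER IDENTITY's antiderivative**: with `G(t) = φ(t) + (½ − t)·φ′(t)` one has `G′(t) = (½ − t)·φ″(t)`, `G(0) = φ(0) + ½φ′(0)`,
`G(1) = φ(1) − ½φ′(1)` — so `φ(1) − ½φ′(1) = ∫₀¹ (½ − t) φ″(t) dt` when `φ(0) = φ′(0) = 0`. [folklore] -/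
theorem hasDerivAt_euler_antiderivative {φ φ' φ'' : ℝ → ℝ} (h1 : ∀ t, HasDerivAt φ (φ' t) t) (h2 : ∀ t, HasDerivAt φ' (φ'' t) t) (t : ℝ) :
    HasDerivAt (fun t => φ t + (1 / 2 - t) * φ' t) ((1 / 2 - t) * φ'' t) t := by
  have ha : HasDerivAt (fun t : ℝ => 1 / 2 - t) (-1) t := (hasDerivAt_id' t).const_sub (1 / 2 : ℝ)
  have h := (h1 t).add (ha.mul (h2 t))
  exact h.congr_deriv (by ring)

/-- ★★ **THE EULER REMAINDER LEMMA** (the analytic core of "`R = F̂ − ½XF̂` is third order"): if `φ(0) = 0`, `φ′(0) = 0` and the second derivative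
oscillates by at most `M` on `[0,1]` (`|φ″(t) − φ″(0)| ≤ M`), then `|φ(1) − ½φ′(1)| ≤ M/2`.  Proof: `K(t) = φ(t) + (½ − t)φ′(t) − (t/2 − t²/2)φ″(0)` has
`K′ = (½ − t)(φ″(t) − φ″(0))`, `|K′| ≤ M/2` on `[0,1]`, `K(0) = 0`, `K(1) = φ(1) − ½φ′(1)` (mean value inequality). [folklore] -/
theorem abs_sub_half_deriv_le_of_osc {φ φ' φ'' : ℝ → ℝ} {M : ℝ} (h1 : ∀ t, HasDerivAt φ (φ' t) t) (h2 : ∀ t, HasDerivAt φ' (φ'' t) t)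
    (h0 : φ 0 = 0) (h0' : φ' 0 = 0) (hM : ∀ t ∈ Icc (0 : ℝ) 1, |φ'' t - φ'' 0| ≤ M) :
    |φ 1 - φ' 1 / 2| ≤ M / 2 := by
  have hK : ∀ t ∈ Icc (0 : ℝ) 1, HasDerivWithinAt (fun t => φ t + (1 / 2 - t) * φ' t - (t / 2 - t * t / 2) * φ'' 0)
      ((1 / 2 - t) * (φ'' t - φ'' 0)) (Icc (0 : ℝ) 1) t := fun t _ => by
    have hp : HasDerivAt (fun t : ℝ => (t / 2 - t * t / 2) * φ'' 0) ((1 / 2 - (1 * t + t * 1) / 2) * φ'' 0) t :=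
      (((hasDerivAt_id' t).div_const 2).sub (((hasDerivAt_id' t).mul (hasDerivAt_id' t)).div_const 2)).mul_const (φ'' 0)
    have h := (hasDerivAt_euler_antiderivative h1 h2 t).sub hp
    refine (h.hasDerivWithinAt).congr_deriv ?_
    ring
  have hbound : ∀ t ∈ Icc (0 : ℝ) 1, ‖(1 / 2 - t) * (φ'' t - φ'' 0)‖ ≤ M / 2 := fun t ht => by
    rw [Real.norm_eq_abs, abs_mul]
    have ha : |1 / 2 - t| ≤ 1 / 2 := abs_le.2 ⟨by linarith [ht.2], by linarith [ht.1]⟩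
    have hM0 : 0 ≤ M := (abs_nonneg _).trans (hM 0 (by simp))
    calc |1 / 2 - t| * |φ'' t - φ'' 0| ≤ 1 / 2 * M := mul_le_mul ha (hM t ht) (abs_nonneg _) (by norm_num)
      _ = M / 2 := by ring
  have h := (convex_Icc (0 : ℝ) 1).norm_image_sub_le_of_norm_hasDerivWithin_le hK hbound (left_mem_Icc.2 zero_le_one) (right_mem_Icc.2 zero_le_one)
  have key : |φ 1 - φ' 1 / 2| = ‖(φ 1 + (1 / 2 - 1) * φ' 1 - (1 / 2 - 1 * 1 / 2) * φ'' 0) -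
      (φ 0 + (1 / 2 - 0) * φ' 0 - (0 / 2 - 0 * 0 / 2) * φ'' 0)‖ := by
    rw [h0, h0', Real.norm_eq_abs]; congr 1; ring
  rw [key]
  refine h.trans ?_
  simp

/-- ★★ **Third-derivative form**: if moreover `φ″` is differentiable with `|φ‴| ≤ M₃` on `[0,1]`, then `|φ(1) − ½φ′(1)| ≤ M₃/2`. [folklore] -/
theorem abs_sub_half_deriv_le_of_third {φ φ' φ'' φ''' : ℝ → ℝ} {M₃ : ℝ} (h1 : ∀ t, HasDerivAt φ (φ' t) t) (h2 : ∀ t, HasDerivAt φ' (φ'' t) t)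
    (h3 : ∀ t, HasDerivAt φ'' (φ''' t) t) (h0 : φ 0 = 0) (h0' : φ' 0 = 0) (hM : ∀ t ∈ Icc (0 : ℝ) 1, |φ''' t| ≤ M₃) :
    |φ 1 - φ' 1 / 2| ≤ M₃ / 2 := by
  refine abs_sub_half_deriv_le_of_osc h1 h2 h0 h0' fun t ht => ?_
  have h := (convex_Icc (0 : ℝ) 1).norm_image_sub_le_of_norm_hasDerivWithin_le (f := φ'') (f' := φ''')
    (fun s _ => (h3 s).hasDerivWithinAt) (fun s hs => by rw [Real.norm_eq_abs]; exact hM s hs) (left_mem_Icc.2 zero_le_one) ht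
  rw [Real.norm_eq_abs, Real.norm_eq_abs, sub_zero] at h
  have hM0 : 0 ≤ M₃ := (abs_nonneg _).trans (hM 0 (by simp))
  calc |φ'' t - φ'' 0| ≤ M₃ * |t| := h
    _ ≤ M₃ * 1 := mul_le_mul_of_nonneg_left (by rw [abs_of_nonneg ht.1]; exact ht.2) hM0
    _ = M₃ := mul_one _

/-- ★ **The exponential clock**: the Euler-flow derivative `d/ds|₀ φ(e^s)` equals `φ′(1)`, so `R = φ(1) − ½·(d/ds|₀ φ(e^s))`. [folklore] -/
theorem hasDerivAt_comp_exp_zero {φ : ℝ → ℝ} {φ'1 : ℝ} (h : HasDerivAt φ φ'1 1) :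
    HasDerivAt (fun s : ℝ => φ (Real.exp s)) φ'1 0 := by
  have he : HasDerivAt Real.exp (Real.exp 0) 0 := Real.hasDerivAt_exp 0
  rw [Real.exp_zero] at he
  have h' : HasDerivAt φ φ'1 (Real.exp 0) := by rw [Real.exp_zero]; exact h
  have hc := h'.comp 0 he
  rw [mul_one] at hc
  exact hc

/-- ★★ **EULER REMAINDER ALONG THE EXPONENTIAL FLOW**: `|φ(1) − ½·deriv (s ↦ φ(e^s)) 0| ≤ M₃/2` under the hypotheses of `abs_sub_half_deriv_le_of_third`
— the form in which `R = F̂ − ½XF̂` (✓`gnoXDeficit`, derivative at `s = 0` of `F̂ ∘ eulerDilate (e^s)`) is bounded by third derivatives of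
`t ↦ F̂(eulerDilate t η)`. [folklore] -/
theorem abs_sub_half_flowDeriv_le_of_third {φ φ' φ'' φ''' : ℝ → ℝ} {M₃ : ℝ} (h1 : ∀ t, HasDerivAt φ (φ' t) t) (h2 : ∀ t, HasDerivAt φ' (φ'' t) t)
    (h3 : ∀ t, HasDerivAt φ'' (φ''' t) t) (h0 : φ 0 = 0) (h0' : φ' 0 = 0) (hM : ∀ t ∈ Icc (0 : ℝ) 1, |φ''' t| ≤ M₃) :
    |φ 1 - deriv (fun s : ℝ => φ (Real.exp s)) 0 / 2| ≤ M₃ / 2 := by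
  rw [(hasDerivAt_comp_exp_zero (h1 1)).deriv]
  exact abs_sub_half_deriv_le_of_third h1 h2 h3 h0 h0' hM

end Summit.QuantumFields.YangMills.Theorems.SwapVirialDeficit.Gnomonic

end
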